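import Summits.QuantumAdvantage.QuantumAdvantage.Theorems.LinnikCubicClassGroupsDegreeOnePrimesEscapeClassPNTOfDensity
import Summits.QuantumAdvantage.QuantumAdvantage.Theorems.LinnikCubicClassGroupsDegreeOnePrimesEscapeClassPNTFamilyDensity
import Summits.QuantumAdvantage.QuantumAdvantage.Theorems.LinnikCubicClassGroupsDegreeOnePrimesEscapeResidueBound
import Literature.NumberTheory.LFunctions.ImaginaryQuadraticResidueBound
import HarnessLib

/-!
# The additive class prime number theorem, VIII: the `κ`-form and its unconditional discharges —
# cubic fields, fields without quadratic subfield, imaginary quadratic fields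

Topic `Summits/QuantumAdvantage/QuantumAdvantage/Theorems`, cell B2b-1 (linnik-cubic), PART A, the
`stub_classPNTAdditive` slice of the line `dedekind-s3-collision` for the crux `DegreeOnePrimesEscape`
(stmt-QuantumAdvantage-11543) of route `LinnikCubicClassGroups`, in DEGREE-LOCAL form.
HONEST FRAMING: the value of this file is a THEOREM (kernel-checked: a GRH-free, Siegel-free, two-sided
prime ideal theorem for every ideal class with the exceptional term explicit) — NOT summit progress.

The registered stub `ClassPNTAdditive` asks, with ONE absolute constant `c₁` for all number fields of all
degrees `> 1`, for the dichotomy: per class `C` and `x ≥ Q^{c₁}` (`Q = |d_K| n^n`, `h = h_K`),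
`|π_C(x) − Li(x)/h| ≤ Li(x)/(32h)`, OR a real class group character `χ₁` with a real zero
`β₁ ∈ (1 − 1/(8 log Q), 1)` of `L(s, χ₁)` and `|π_C(x) − (Li(x) − Re χ₁(C) Li(x^{β₁}))/h| ≤ Li(x)/(32h)`
(Thorner–Zaman 2019, Thm 1.4 for the Hilbert class field, MINUS the Deuring–Heilbronn phenomenon).  The
tree's log-free zero-density estimates (`logFreeDensity_classGroup_all`, `logFreeDensity_dedekindZeta₁_all`)
have degree-dependent constants and carry the residue hypothesis `κ_K ≥ 1/P`; accordingly this file proves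
the dichotomy with a constant `c₁ = c₁(n, A)` for the fields of ONE degree `n > 1` with `κ_K ≥ Q^{−A}`
(`classPNTAdditive_of_kappa_local`), and discharges the residue hypothesis UNCONDITIONALLY where the tree can:

* `classPNTAdditive_three` — every CUBIC number field (`κ_K ≥ Q^{−10}`, Stark: no quadratic subfield;
  `Residue.residueLowerBound_three`);
* `classPNTAdditive_of_noQuadraticSubfield (n)` — every field of degree `n > 1` without quadratic subfield
  (`Residue.condQn_rpow_neg_ten_le_residue`);
* `classPNTAdditive_imaginaryQuadratic` — every imaginary quadratic field (class number formula,
  `condQ_inv_le_dedekindZeta_residue`; the additive form of the vendored named fact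
  `ThornerZaman2019_classPNT_imaginaryQuadratic`).

## References

* J. Thorner, A. Zaman, ANT 13 (2019), Thm 1.4, Thm 3.1–3.2, §4–5. [ThornerZaman2019]
* A. Weiss, J. reine angew. Math. 338 (1983), Thm 4.3, Thm 5.2. [Weiss1983]
* J. Lagarias, H. Montgomery, A. Odlyzko, Invent. Math. 54 (1979). [LagariasMontgomeryOdlyzko1979]
-/

noncomputable section

open Complex Real MeasureTheory Set Filter Topology
open scoped NumberField nonZeroDivisors

namespace Summit.QuantumAdvantage.QuantumAdvantage.Theorems.DegreeOnePrimesEscape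

open Literature.NumberTheory.LFunctions Literature.NumberTheory.LFunctions.NumberField
  Literature.NumberTheory.LFunctions.AbelianDensity

/-! ### The `κ`-form -/

/-- **The additive class prime number theorem dichotomy, `κ`-form, one degree.**  For every `n > 1` and
real `A` there is `c₁ > 0` such that for every number field `K` of degree `n` with `κ_K ≥ Q^{−A}`
(`Q = |d_K| n^n`, `h = h_K`, `Li(x) = ∫₂ˣ dt/log t`): EITHER `|π_C(x) − Li(x)/h| ≤ Li(x)/(32h)` for every class
`C` and every `x ≥ Q^{c₁}`, OR there are a real class group character `χ₁` and a real zero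
`β₁ ∈ (1 − 1/(8 log Q), 1)` of `L(s, χ₁)` with `|π_C(x) − (Li(x) − Re χ₁(C) Li(x^{β₁}))/h| ≤ Li(x)/(32h)` for
every `C` and every `x ≥ Q^{c₁}`. -/
theorem classPNTAdditive_of_kappa_local (n : ℕ) (hn : 1 < n) (A : ℝ) :
    ∃ c₁ : ℝ, 0 < c₁ ∧ ∀ (K : Type) [Field K] [NumberField K], Module.finrank ℚ K = n →
      ThornerZaman.condQn K ^ (-A) ≤ NumberField.dedekindZeta_residue K →
      ((∀ (C : ClassGroup (𝓞 K)) (x : ℝ), ThornerZaman.condQn K ^ c₁ ≤ x →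
          |(primeIdealClassCount K C x : ℝ) - offsetLogIntegral x / NumberField.classNumber K| ≤
            offsetLogIntegral x / (32 * NumberField.classNumber K)) ∨
        ∃ (χ₁ : ClassGroup (𝓞 K) →* ℂˣ) (β₁ : ℝ), χ₁ * χ₁ = 1 ∧
          1 - 1 / (8 * Real.log (ThornerZaman.condQn K)) < β₁ ∧ β₁ < 1 ∧
          classGroupLFunction K χ₁ β₁ = 0 ∧
          ∀ (C : ClassGroup (𝓞 K)) (x : ℝ), ThornerZaman.condQn K ^ c₁ ≤ x →
            |(primeIdealClassCount K C x : ℝ) -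
                (offsetLogIntegral x - ((χ₁ C : ℂ)).re * offsetLogIntegral (x ^ β₁)) /
                  NumberField.classNumber K| ≤
              offsetLogIntegral x / (32 * NumberField.classNumber K)) := by
  obtain ⟨b, D, hb, hD, hdens⟩ := fam_density_local n hn A
  have ha : (1 : ℝ) ≤ max A 4 := le_trans (by norm_num) (le_max_right _ _)
  obtain ⟨c₁, hc₁, h⟩ := classPNTAdditive_of_famDensity n hn hb hD ha
  exact ⟨c₁, hc₁, fun K _ _ hKn hκ ↦ h K hKn (hdens K hKn hκ)⟩

/-! ### Unconditional discharges -/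

/-- **The additive class prime number theorem dichotomy for CUBIC fields, unconditional** (GRH-free,
Siegel-free): there is an absolute `c₁ > 0` such that for every number field `K` of degree `3`, EITHER
`|π_C(x) − Li(x)/h| ≤ Li(x)/(32h)` for every ideal class `C` and every `x ≥ Q^{c₁}` (`Q = 27|d_K|`), OR there are
a real class group character `χ₁` and a real zero `β₁ ∈ (1 − 1/(8 log Q), 1)` of `L(s, χ₁)` with
`|π_C(x) − (Li(x) − Re χ₁(C) Li(x^{β₁}))/h| ≤ Li(x)/(32h)` for every `C`, every `x ≥ Q^{c₁}`
(residue bound `κ_K ≥ Q^{−10}` from Stark's lemma, cubic fields having no quadratic subfield). -/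
theorem classPNTAdditive_three :
    ∃ c₁ : ℝ, 0 < c₁ ∧ ∀ (K : Type) [Field K] [NumberField K], Module.finrank ℚ K = 3 →
      ((∀ (C : ClassGroup (𝓞 K)) (x : ℝ), ThornerZaman.condQn K ^ c₁ ≤ x →
          |(primeIdealClassCount K C x : ℝ) - offsetLogIntegral x / NumberField.classNumber K| ≤
            offsetLogIntegral x / (32 * NumberField.classNumber K)) ∨
        ∃ (χ₁ : ClassGroup (𝓞 K) →* ℂˣ) (β₁ : ℝ), χ₁ * χ₁ = 1 ∧
          1 - 1 / (8 * Real.log (ThornerZaman.condQn K)) < β₁ ∧ β₁ < 1 ∧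
          classGroupLFunction K χ₁ β₁ = 0 ∧
          ∀ (C : ClassGroup (𝓞 K)) (x : ℝ), ThornerZaman.condQn K ^ c₁ ≤ x →
            |(primeIdealClassCount K C x : ℝ) -
                (offsetLogIntegral x - ((χ₁ C : ℂ)).re * offsetLogIntegral (x ^ β₁)) /
                  NumberField.classNumber K| ≤
              offsetLogIntegral x / (32 * NumberField.classNumber K)) := by
  obtain ⟨c₁, hc₁, h⟩ := classPNTAdditive_of_kappa_local 3 (by norm_num) 10
  exact ⟨c₁, hc₁, fun K _ _ hK ↦ h K hK (Residue.residueLowerBound_three K hK)⟩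

/-- **The additive class prime number theorem dichotomy for the fields of degree `n > 1` WITHOUT
QUADRATIC SUBFIELD, unconditional**: for every `n > 1` there is `c₁ > 0` such that every number field
`K` of degree `n` with no intermediate field of degree `2` satisfies the dichotomy of
`classPNTAdditive_of_kappa_local` (residue bound `κ_K ≥ Q^{−10}` from Stark's lemma). -/
theorem classPNTAdditive_of_noQuadraticSubfield (n : ℕ) (hn : 1 < n) :
    ∃ c₁ : ℝ, 0 < c₁ ∧ ∀ (K : Type) [Field K] [NumberField K], Module.finrank ℚ K = n →
      (∀ F : IntermediateField ℚ K, Module.finrank ℚ F ≠ 2) →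
      ((∀ (C : ClassGroup (𝓞 K)) (x : ℝ), ThornerZaman.condQn K ^ c₁ ≤ x →
          |(primeIdealClassCount K C x : ℝ) - offsetLogIntegral x / NumberField.classNumber K| ≤
            offsetLogIntegral x / (32 * NumberField.classNumber K)) ∨
        ∃ (χ₁ : ClassGroup (𝓞 K) →* ℂˣ) (β₁ : ℝ), χ₁ * χ₁ = 1 ∧
          1 - 1 / (8 * Real.log (ThornerZaman.condQn K)) < β₁ ∧ β₁ < 1 ∧
          classGroupLFunction K χ₁ β₁ = 0 ∧
          ∀ (C : ClassGroup (𝓞 K)) (x : ℝ), ThornerZaman.condQn K ^ c₁ ≤ x →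
            |(primeIdealClassCount K C x : ℝ) -
                (offsetLogIntegral x - ((χ₁ C : ℂ)).re * offsetLogIntegral (x ^ β₁)) /
                  NumberField.classNumber K| ≤
              offsetLogIntegral x / (32 * NumberField.classNumber K)) := by
  obtain ⟨c₁, hc₁, h⟩ := classPNTAdditive_of_kappa_local n hn 10
  exact ⟨c₁, hc₁, fun K _ _ hK hnq ↦
    h K hK (Residue.condQn_rpow_neg_ten_le_residue K (by rw [hK]; exact hn) hnq)⟩

/-- **The additive class prime number theorem dichotomy for IMAGINARY QUADRATIC fields, unconditional**
(the additive form — without the Deuring–Heilbronn relative error — of the vendored named fact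
`ThornerZaman2019_classPNT_imaginaryQuadratic`; residue bound `κ_K ≥ 1/Q`, `Q = 4|d_K|`, from the class
number formula): there is `c₁ > 0` such that every imaginary quadratic field satisfies the dichotomy of
`classPNTAdditive_of_kappa_local`. -/
theorem classPNTAdditive_imaginaryQuadratic :
    ∃ c₁ : ℝ, 0 < c₁ ∧ ∀ (K : Type) [Field K] [NumberField K], Module.finrank ℚ K = 2 →
      NumberField.IsTotallyComplex K →
      ((∀ (C : ClassGroup (𝓞 K)) (x : ℝ), ThornerZaman.condQn K ^ c₁ ≤ x →
          |(primeIdealClassCount K C x : ℝ) - offsetLogIntegral x / NumberField.classNumber K| ≤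
            offsetLogIntegral x / (32 * NumberField.classNumber K)) ∨
        ∃ (χ₁ : ClassGroup (𝓞 K) →* ℂˣ) (β₁ : ℝ), χ₁ * χ₁ = 1 ∧
          1 - 1 / (8 * Real.log (ThornerZaman.condQn K)) < β₁ ∧ β₁ < 1 ∧
          classGroupLFunction K χ₁ β₁ = 0 ∧
          ∀ (C : ClassGroup (𝓞 K)) (x : ℝ), ThornerZaman.condQn K ^ c₁ ≤ x →
            |(primeIdealClassCount K C x : ℝ) -
                (offsetLogIntegral x - ((χ₁ C : ℂ)).re * offsetLogIntegral (x ^ β₁)) /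
                  NumberField.classNumber K| ≤
              offsetLogIntegral x / (32 * NumberField.classNumber K)) := by
  obtain ⟨c₁, hc₁, h⟩ := classPNTAdditive_of_kappa_local 2 (by norm_num) 1
  refine ⟨c₁, hc₁, fun K _ _ hK htc ↦ h K hK ?_⟩
  have hd : NumberField.discr K < 0 := discr_neg_of_isTotallyComplex hK htc
  have h1 := condQ_inv_le_dedekindZeta_residue hK hd
  have hQ : ThornerZaman.condQn K = ThornerZaman.condQ K := ThornerZaman.condQn_eq_condQ K hK
  rw [hQ, Real.rpow_neg_one]
  exact h1

end Summit.QuantumAdvantage.QuantumAdvantage.Theorems.DegreeOnePrimesEscape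

end
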